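import Summits.BirchSwinnertonDyer.Rank1Residual.SmallImageMu.KatoDivisibility
import Summits.BirchSwinnertonDyer.BirchSwinnertonDyer.Theorems.Rank1ResidualX9TwistCriterion
import Summits.BirchSwinnertonDyer.BirchSwinnertonDyer.Theses.SmallImageMuTransfer
import Summits.BirchSwinnertonDyer.Rank1Residual.X9.TwistStability
import Literature.NumberTheory.EllipticCurves.BurungaleCastellaSkinner2025.CyclotomicProductDivisibility
import Literature.NumberTheory.EllipticCurves.CyclotomicIwasawaMainTheoremIrreducibleBaseChangeProofs
import Literature.NumberTheory.EllipticCurves.ModularParametrizationBCDTProofs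
import Literature.NumberTheory.EllipticCurves.Rank1Residual.MuLambdaCarriers
import HarnessLib
import HarnessLib.Audit

/-!
# Kernel edges of the node `KatoDivisibilityOnClassX9` (cell `bsd-f3-mu`, typer seat): its two
# readings, its place between items 19629 / 19630 and `IntegralMainConjectureOnClassX9`, and the
# FOUR-TWIST SQUEEZE through the printed integral display (5.3) of Burungale–Castella–Skinner

HONEST FRAMING (cell `bsd-f3-mu`, D-0131 (3) FRONTIER TIER; HOME `run/shared/lean/pub/bsd-f3-mu/`).
THEOREMS ONLY, sorry-free; no definition, no named fact, no new conjecture; nothing is booked: every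
statement is CONDITIONAL on the open node `KatoDivisibilityOnClassX9` (sibling leaf
`KatoDivisibility.lean`) and/or on PUBLISHED named facts taken as binders (BCS 2025 Thm. 1.1.2 (a)
`hBCS`, display (5.3) `h53`, period unit `h5`, modularity `hmod`), as in the planners' checked Sketches
(`HOME/es/Sketch.lean` sha16 5c6ff41bbbdd79bd, `HOME/imc/Sketch.lean` sha16 a269a77c30810761; refuters:
REF1-AUDIT §3.1 S-imc-1 «SUPPORT VERIFIED — rc0, 0 sorry, std axioms; logic re-derived»; REF2-LITMAP §3:
the squeeze is BCS's closing sentence [arXiv:2405.00270v2 p. 10 «a proper divisibility in (5.4) would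
contradict (5.3)»] with (5.4)-under-(im) replaced by the node), ported to the filed names and the
Literature carriers of `Rank1Residual/MuLambdaCarriers.lean`.

* §1 READINGS: `katoDivisibilityOnClassX9_iff` (node ⟺ ∀ X9 pairs, `KatoDivisibilityAt`);
  `katoDivisibilityOnClassX9_iff_muDefectNonpos` (⟺ ∀ X9 pairs, `k ≤ 0`, granted BCS (a) — the `-imc`
  spelling `KatoOneSidedMuOnClassX9`); `eisensteinOneSidedMuOnClassX9_iff`;
  `katoDivisibilityOnClassX9_of_irreducibleNonCM` (C1⁺ ⟹ C1);
  `katoDivisibilityOnClassX9_of_integralMainConjectureOnClassX9`;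
  `eisensteinOneSidedMuOnClassX9_of_analyticMuZeroOnClassX9` (item 19630 ⟹ the mirror; ref1's lemma);
  `integralMainConjectureOnClassX9_of_kato_of_eisenstein` (both one-sided nodes ⟹ IMC on X9).
* §2 VERSUS 19629 / 19630: `muAlgZeroAt_of_katoDivisibilityAt_of_muAnZeroAt` (per pair: divisibility +
  unit coefficient + BCS (a) ⟹ `μ(X) = 0`, so the node implies `KatoMuTransfer` restricted to X9);
  `integralMainConjectureOnClassX9_of_katoDivisibility_of_analyticMuZero` (node + 19630 ⟹ IMC on X9:
  the node can replace 19629 in the K6 assembly).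
* §3 THE SQUEEZE (`-imc`, S-imc-1): `integralMainConjectureOnClassX9_of_katoDivisibility_squeeze` —
  node + (5.3) + BCS (a) + period unit + modularity ⟹ `IntegralMainConjectureOnClassX9`, with NO
  analytic `μ = 0` (19630) and NO Greenberg conjecture among the hypotheses; and the leaf
  `bsdpOnClassX9_of_katoDivisibility_squeeze` (+ the SmallImageMuTransfer route's shared items
  `PublishedInputsX9` = stmt-19632 and `SchneiderX9RankOne` = stmt-19631) ⟹ `BSDpOnClassX9`.

References: [BurungaleCastellaSkinner2025] Thm. 1.1.2 (a), (5.3)–(5.4) p. 10; [Kato2004Asterisque]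
Thm. 17.4 (3); [GreenbergVatsal2000] Prop. 3.7, Rem. 3.4; [RohrlichInventiones1984]; [GreenbergLNM1716]
Thm. 4.1; HOME MEMO-es.md §3, MEMO-imc.md §3–§4, REF1-AUDIT.md §3.1, REF2-LITMAP.md §3.
-/

-- the summit and its single problem are both named `BirchSwinnertonDyer` (registry layout D-0017)
set_option linter.dupNamespace false

noncomputable section

open scoped Classical MatrixGroups ModularForm

open CongruenceSubgroup WeierstrassCurve Literature.NumberTheory.EllipticCurves
  Literature.NumberTheory.EllipticCurves.ModularForms
  Literature.NumberTheory.EllipticCurves.BurungaleCastellaSkinner2025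
  Summit.BirchSwinnertonDyer.BirchSwinnertonDyer.Rank1Residual
-- carriers and census bits from the Literature residual namespace, by name only (its census `ClassX9`,
-- with the rank-1 clause, must not shadow the `μ`-version `Rank1ResidualX9Defs.ClassX9` used here)
open Literature.NumberTheory.EllipticCurves.Rank1Residual (KatoDivisibilityAt MuDefectNonposAt
  MuDefectNonnegAt MuAnZeroAt MuAlgZeroAt integralMainConjectureAt_of_muDefect norm_periodRatio_eq_one
  mazurMainConjecture_of_mu_eq_zero)

namespace Summit.BirchSwinnertonDyer.Rank1Residual.SmallImageMu

/-! ## §1 Readings of the node -/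

section Readings

/-- **The node per pair**: `KatoDivisibilityOnClassX9` is literally "every X9 pair has
`KatoDivisibilityAt`". [cite: Kato2004Asterisque, Thm. 17.4 (3) (shape)] -/
theorem katoDivisibilityOnClassX9_iff :
    KatoDivisibilityOnClassX9 ↔
      ∀ (W : WeierstrassCurve ℚ) [W.IsElliptic] [W.IsGloballyMinimal] (p : ℕ) [Fact p.Prime],
        ClassX9 W p → KatoDivisibilityAt W p := by
  constructor
  · intro h W _ _ p _ hX9 κ γ N _ f hκ hγ hγ' hf D
    exact h W p κ γ f hX9 hκ hγ hγ' hf D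
  · intro h W _ _ p _ κ γ N _ f hX9 hκ hγ hγ' hf D
    exact h W p hX9 κ γ f hκ hγ hγ' hf D

/-- **The node in the exponent currency** (the `-imc` spelling `KatoOneSidedMuOnClassX9`): granted
BCS 2025 Thm. 1.1.2 (a), `KatoDivisibilityOnClassX9` ⟺ "the `μ`-defect `k ≤ 0` at every X9 pair"
(per pair `Rank1Residual.katoDivisibilityAt_iff_muDefectNonposAt`: Rohrlich one way, BCS (a) back).
[cite: BurungaleCastellaSkinner2025, Thm. 1.1.2 (a) (p. 2 of arXiv:2405.00270v2)] -/
theorem katoDivisibilityOnClassX9_iff_muDefectNonpos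
    (hBCS : burungale_castella_skinner_charIdeal_eq_padicLFunction) :
    KatoDivisibilityOnClassX9 ↔
      ∀ (W : WeierstrassCurve ℚ) [W.IsElliptic] [W.IsGloballyMinimal] (p : ℕ) [Fact p.Prime],
        ClassX9 W p → MuDefectNonposAt W p := by
  rw [katoDivisibilityOnClassX9_iff]
  constructor
  · intro h W _ _ p _ hX9
    obtain ⟨-, -, hgood, hord, -, -⟩ := id hX9
    exact (h W p hX9).muDefectNonposAt ⟨hgood, hord⟩
  · intro h W _ _ p _ hX9
    obtain ⟨-, hp, hgood, hord, hirr, -⟩ := id hX9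
    exact (h W p hX9).katoDivisibilityAt hBCS hp hgood hord hirr

/-- **The mirror per pair**: `EisensteinOneSidedMuOnClassX9` is "every X9 pair has `MuDefectNonnegAt`".
[cite: BurungaleCastellaSkinner2025, display (5.3) (shape)] -/
theorem eisensteinOneSidedMuOnClassX9_iff :
    EisensteinOneSidedMuOnClassX9 ↔
      ∀ (W : WeierstrassCurve ℚ) [W.IsElliptic] [W.IsGloballyMinimal] (p : ℕ) [Fact p.Prime],
        ClassX9 W p → MuDefectNonnegAt W p :=
  Iff.rfl

/-- **C1⁺ ⟹ C1**: an X9 pair is non-CM, `p ≥ 5`, good ordinary, irreducible. [folklore] -/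
theorem katoDivisibilityOnClassX9_of_irreducibleNonCM (h : KatoDivisibilityIrreducibleNonCM) :
    KatoDivisibilityOnClassX9 := by
  intro W _ _ p _ κ γ N _ f hX9 hκ hγ hγ' hf D
  obtain ⟨hcm, hp, hgood, hord, hirr, -⟩ := id hX9
  exact h W p f hp hgood hord hirr hcm hf κ γ hκ hγ hγ' D

/-- **The integral main conjecture on X9 trivially gives the node** (take the generator itself).
[folklore] -/
theorem katoDivisibilityOnClassX9_of_integralMainConjectureOnClassX9
    (h : IntegralMainConjectureOnClassX9) : KatoDivisibilityOnClassX9 := by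
  intro W _ _ p _ κ γ N _ f hX9 hκ hγ hγ' hf D
  obtain ⟨-, g, hchar, hιg⟩ := h W p κ γ f hX9 hκ hγ hγ' hf D
  exact ⟨g, by rw [hchar]; exact Ideal.mem_span_singleton_self g, hιg⟩

/-- **Item 19630 ⟹ the mirror** (ref1's lemma `eisensteinOneSided_of_analyticMuZero`, by name through
the carrier lemma `MuAnZeroAt.muDefectNonnegAt`: a unit coefficient of `L_p` and `ι g = p^k L_p` with
`g ∈ Λ` force `0 ≤ k`). [cite: GreenbergVatsal2000, p. 2, (2)] -/
theorem eisensteinOneSidedMuOnClassX9_of_analyticMuZeroOnClassX9 (hA : AnalyticMuZeroOnClassX9) :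
    EisensteinOneSidedMuOnClassX9 := by
  intro W _ _ p _ hX9
  have hAn : MuAnZeroAt W p := fun f hf => hA W p f hX9 hf
  exact hAn.muDefectNonnegAt

/-- **Both one-sided nodes ⟹ the integral main conjecture on X9** (granted BCS (a): `k ≤ 0 ∧ 0 ≤ k`
pins the exponent, `Rank1Residual.integralMainConjectureAt_of_muDefect`).
[cite: BurungaleCastellaSkinner2025, Thm. 1.1.2 (a) (p. 2 of arXiv:2405.00270v2)] -/
theorem integralMainConjectureOnClassX9_of_kato_of_eisenstein
    (hBCS : burungale_castella_skinner_charIdeal_eq_padicLFunction)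
    (hK : KatoDivisibilityOnClassX9) (hE : EisensteinOneSidedMuOnClassX9) :
    IntegralMainConjectureOnClassX9 := by
  intro W _ _ p _ κ γ N _ f hX9 hκ hγ hγ' hf D
  obtain ⟨-, hp, hgood, hord, hirr, -⟩ := id hX9
  have hle : MuDefectNonposAt W p :=
    ((katoDivisibilityOnClassX9_iff_muDefectNonpos hBCS).mp hK) W p hX9
  have hge : MuDefectNonnegAt W p := (eisensteinOneSidedMuOnClassX9_iff.mp hE) W p hX9
  exact integralMainConjectureAt_of_muDefect hBCS hp hgood hord hirr hle hge κ γ f hκ hγ hγ' hf D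

end Readings

/-! ## §2 Versus items 19629 (`KatoMuTransfer`) and 19630 (`AnalyticMuZeroOnClassX9`) -/

section Items

variable {W : WeierstrassCurve ℚ} [W.IsElliptic] [W.IsGloballyMinimal] {p : ℕ} [Fact p.Prime]

/-- **Per pair: divisibility + one unit coefficient of `L_p` + BCS (a) ⟹ `μ(X) = 0`** (the `-es`
lemma `mu_eq_zero_of_divisibility_of_cert` in carrier currency).  If `g ∈ char_Λ X = (g₀)` with
`ι g = L_p(f, α)` and some coefficient of `L_p(f, α)` is a unit, then `g`, hence `g₀`, has unit content,
i.e. `μ(X) = 0`.  So `KatoDivisibilityAt ∧ MuAnZeroAt ⟹ MuAlgZeroAt` at `p ≥ 5` good ordinary with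
`E[p]` irreducible (through any newform `f` of `E` — one exists by modularity): the node implies
item 19629 (`KatoMuTransfer`) restricted to class X9.
[cite: BurungaleCastellaSkinner2025, Thm. 1.1.2 (a) (p. 2 of arXiv:2405.00270v2)]
[cite: GreenbergVatsal2000, p. 2, (2) and Prop. 3.7] -/
theorem muAlgZeroAt_of_katoDivisibilityAt_of_muAnZeroAt
    (hBCS : burungale_castella_skinner_charIdeal_eq_padicLFunction) (hp : 5 ≤ p)
    (hgood : W.HasGoodReductionAtPrime p) (hord : ¬ (p : ℤ) ∣ W.frobeniusTrace p)
    (hirr : W.HasIrreducibleModPGaloisRep p) {N : ℕ} [NeZero N] {f : CuspForm (Gamma0 N) 2}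
    (hf : IsNewformOf W f) (hdiv : KatoDivisibilityAt W p) (hcert : MuAnZeroAt W p) :
    MuAlgZeroAt W p := by
  intro κ γ hκ hγ hγ' D
  haveI : Module.Finite (IwasawaAlgebra p) D.X := D.module_finite_holds hγ
  obtain ⟨hX, g₀, k, hchar, -⟩ := hBCS W p κ γ f hp hgood hord hirr hκ hγ hγ' hf D
  obtain ⟨g, hg, hιg⟩ := hdiv κ γ f hκ hγ hγ' hf D
  have hug : GreenbergVatsal2000.HasUnitContent g :=
    Literature.NumberTheory.EllipticCurves.Rank1Residual.hasUnitContent_of_map_eq g _ hιg (hcert f hf)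
  have hug₀ : GreenbergVatsal2000.HasUnitContent g₀ := by
    rw [GreenbergVatsal2000.hasUnitContent_iff_not_C_dvd] at hug ⊢
    intro hdvd
    apply hug
    rw [hchar, Ideal.mem_span_singleton] at hg
    exact hdvd.trans hg
  exact (GreenbergVatsal2000.mu_eq_zero_iff_hasUnitContent D hX hchar).mpr hug₀

/-- **Node + item 19630 ⟹ the integral main conjecture on X9** (granted BCS (a)), along the K6
assembly `integralMainConjectureOnClassX9_of_katoMuTransfer` with `KatoMuTransfer` (19629) REPLACED by
the node: per pair `μ(X) = 0` (`muAlgZeroAt_of_katoDivisibilityAt_of_muAnZeroAt`), then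
`Rank1Residual.mazurMainConjecture_of_mu_eq_zero` (BCS (a) + GV Prop. 3.7 + the unit coefficient) pins
`k = 0`.  (Equivalently, in the exponent currency: 19630 gives `0 ≤ k`
— `eisensteinOneSidedMuOnClassX9_of_analyticMuZeroOnClassX9` — and the node `k ≤ 0`,
`integralMainConjectureOnClassX9_of_kato_of_eisenstein`.)
[cite: BurungaleCastellaSkinner2025, Thm. 1.1.2 (a) (p. 2 of arXiv:2405.00270v2)]
[cite: GreenbergVatsal2000, Prop. 3.7] -/
theorem integralMainConjectureOnClassX9_of_katoDivisibility_of_analyticMuZero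
    (hBCS : burungale_castella_skinner_charIdeal_eq_padicLFunction)
    (hK : KatoDivisibilityOnClassX9) (hA : AnalyticMuZeroOnClassX9) :
    IntegralMainConjectureOnClassX9 := by
  intro W _ _ p _ κ γ N _ f hX9 hκ hγ hγ' hf D
  obtain ⟨-, hp, hgood, hord, hirr, -⟩ := id hX9
  have hdiv : KatoDivisibilityAt W p := (katoDivisibilityOnClassX9_iff.mp hK) W p hX9
  have hAn : MuAnZeroAt W p := fun f' hf' => hA W p f' hX9 hf'
  have hμ : D.mu = 0 :=
    muAlgZeroAt_of_katoDivisibilityAt_of_muAnZeroAt hBCS hp hgood hord hirr hf hdiv hAn κ γ hκ hγ hγ' D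
  exact mazurMainConjecture_of_mu_eq_zero hBCS W p hp hgood hord hirr κ γ hκ hγ hγ' f hf D hμ
    (hA W p f hX9 hf)

end Items

/-! ## §3 The four-twist squeeze (S-imc-1): node + printed facts ⟹ `IntegralMainConjectureOnClassX9` -/

section Squeeze

/-- A rational `ϖ` with `ϖ · Ω_E = Ω⁺_f` exists at `p ≥ 5` good with `E[p]` irreducible (from the named
fact `realPeriodRat_eq_unit_mul_plusPeriod`: `Ω_E = u · Ω⁺_f`, `|u|_p = 1`; take `ϖ = u⁻¹`).
[cite: GreenbergVatsal2000, §3 Rem. 3.4] -/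
theorem exists_periodRatio (h5 : realPeriodRat_eq_unit_mul_plusPeriod)
    (W : WeierstrassCurve ℚ) [W.IsElliptic] [W.IsGloballyMinimal] (p : ℕ) [Fact p.Prime]
    (hp : 5 ≤ p) (hgood : W.HasGoodReductionAtPrime p) (hirr : W.HasIrreducibleModPGaloisRep p)
    {N : ℕ} [NeZero N] (f : CuspForm (Gamma0 N) 2) (hf : IsNewformOf W f) :
    ∃ ϖ : ℚ, (ϖ : ℝ) * W.realPeriodRat = plusPeriod f := by
  obtain ⟨u, hu1, huΩ⟩ := h5 W p hp hgood hirr f hf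
  have hu0 : u ≠ 0 := by
    rintro rfl
    simp at hu1
  refine ⟨u⁻¹, ?_⟩
  rw [huΩ, Rat.cast_inv, ← mul_assoc, inv_mul_cancel₀ (by exact_mod_cast hu0), one_mul]

/-- **The four-twist squeeze (certified glue; `-imc` S-imc-1, ported).**  `KatoDivisibilityOnClassX9`,
the PRINTED integral four-fold divisibility (5.3) of Burungale–Castella–Skinner (tree fact
`display53_prod_charIdeal_le_prod_padicLFunction`, `h53`), their Thm. 1.1.2 (a) (`hBCS`), the period
unit (`h5`) and modularity (`hmod`) imply the integral cyclotomic main conjecture on class X9 — with NO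
analytic `μ = 0` (item 19630) and NO Greenberg conjecture among the hypotheses.  Proof: for an X9 pair
`(E, p)` take the admissible `(d_K, d_F)` of (5.3); the globally minimal models `E₁, E₂, E₃` of
`E^{d_K}, E^{d_F}, E^{d_K d_F}` are again X9 pairs at `p` (`X9.classX9_of_smul_eq_quadraticTwist`,
`p ∤ d_K d_F`); BCS (a) gives `ch X(Eᵢ) = (gᵢ)`, `ι gᵢ = p^{kᵢ} L_p(Eᵢ)`; the node (exponent form)
gives `kᵢ ≤ 0` four times; (5.3) gives `g₀ g₁ g₂ g₃ ∈ (G)` with `ι G = ∏ ϖᵢ L_p(Eᵢ)`, `|ϖᵢ|_p = 1`;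
applying `ι` and cancelling `∏ L_p(Eᵢ) ≠ 0` (Rohrlich) yields `ι(r) · ∏ ϖᵢ = p^{Σ kᵢ}` with `r ∈ Λ`,
whence `Σ kᵢ ≥ 0`, so every `kᵢ = 0`, in particular `ι g₀ = L_p(E)` — BCS's closing sentence «a proper
divisibility in (5.4) would contradict (5.3)» with (5.4)-under-(im) replaced by the node.
[cite: BurungaleCastellaSkinner2025, Proof of Thm. 1.1.2, displays (5.3)–(5.4), p. 10 of arXiv:2405.00270v2] -/
theorem integralMainConjectureOnClassX9_of_katoDivisibility_squeeze
    (hC1 : KatoDivisibilityOnClassX9)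
    (h53 : display53_prod_charIdeal_le_prod_padicLFunction)
    (hBCS : burungale_castella_skinner_charIdeal_eq_padicLFunction)
    (h5 : realPeriodRat_eq_unit_mul_plusPeriod)
    (hmod : exists_isNewformOf) :
    IntegralMainConjectureOnClassX9 := by
  have hKMI := (katoDivisibilityOnClassX9_iff_muDefectNonpos hBCS).mp hC1
  intro W _ _ p _ κ γ N _ f hX9 hκ hγ hγ' hf D
  obtain ⟨-, hp, hgood, hord, hirr, -⟩ := id hX9
  have hpP : p.Prime := Fact.out
  have hpZ : Prime (p : ℤ) := Nat.prime_iff_prime_int.mp hpP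
  -- BCS Thm 1.1.2 (a) at `E`
  obtain ⟨htors, g₀, k₀, hg₀, hι₀⟩ := hBCS W p κ γ f hp hgood hord hirr hκ hγ hγ' hf D
  refine ⟨htors, ?_⟩
  -- the admissible pair of (5.3)
  obtain ⟨dK, dF, hK0, -, hKsq, -, hF1, -, hFsq, hKF, hcop, -, -, H⟩ :=
    h53 W p κ γ f hp hgood hord hirr hκ hγ hγ' hf
  have hpunit : ¬ IsUnit (p : ℤ) := by
    rw [Int.isUnit_iff_natAbs_eq, Int.natAbs_natCast]
    exact hpP.one_lt.ne'
  have hpK : ¬ (p : ℤ) ∣ dK := fun h =>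
    hpunit (hcop.isUnit_of_dvd' (dvd_mul_of_dvd_left h _) (dvd_mul_right _ _))
  have hpF : ¬ (p : ℤ) ∣ dF := fun h =>
    hpunit (hcop.isUnit_of_dvd' (dvd_mul_of_dvd_right h _) (dvd_mul_right _ _))
  have hpKF : ¬ (p : ℤ) ∣ dK * dF := fun h => (hpZ.dvd_or_dvd h).elim hpK hpF
  have hKFsq : Squarefree (dK * dF) := squarefree_mul_iff.mpr ⟨hKF.isRelPrime, hKsq, hFsq⟩
  have hF0 : dF ≠ 0 := by omega
  have hK0' : (dK : ℚ) ≠ 0 := by exact_mod_cast hK0.ne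
  have hF0' : (dF : ℚ) ≠ 0 := by exact_mod_cast hF0
  have hKF0' : ((dK * dF : ℤ) : ℚ) ≠ 0 := by exact_mod_cast mul_ne_zero hK0.ne hF0
  -- globally minimal models of the three twists: again X9 pairs at `p`
  obtain ⟨W₁, hE₁, hM₁, C₁, hC₁⟩ := exists_isGloballyMinimal_smul_eq_quadraticTwist W hK0'
  obtain ⟨W₂, hE₂, hM₂, C₂, hC₂⟩ := exists_isGloballyMinimal_smul_eq_quadraticTwist W hF0'
  obtain ⟨W₃, hE₃, hM₃, C₃, hC₃⟩ := exists_isGloballyMinimal_smul_eq_quadraticTwist W hKF0'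
  have hX9₁ : ClassX9 W₁ p := X9.classX9_of_smul_eq_quadraticTwist W W₁ p hX9 hKsq hC₁ hpK
  have hX9₂ : ClassX9 W₂ p := X9.classX9_of_smul_eq_quadraticTwist W W₂ p hX9 hFsq hC₂ hpF
  have hX9₃ : ClassX9 W₃ p := X9.classX9_of_smul_eq_quadraticTwist W W₃ p hX9 hKFsq hC₃ hpKF
  obtain ⟨-, -, hgood₁, hord₁, hirr₁, -⟩ := id hX9₁
  obtain ⟨-, -, hgood₂, hord₂, hirr₂, -⟩ := id hX9₂
  obtain ⟨-, -, hgood₃, hord₃, hirr₃, -⟩ := id hX9₃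
  -- their newforms (modularity) and Selmer data
  haveI : NeZero (W₁.conductorNorm ℤ) := ⟨(conductorNorm_pos_holds W₁).ne'⟩
  haveI : NeZero (W₂.conductorNorm ℤ) := ⟨(conductorNorm_pos_holds W₂).ne'⟩
  haveI : NeZero (W₃.conductorNorm ℤ) := ⟨(conductorNorm_pos_holds W₃).ne'⟩
  obtain ⟨f₁, hf₁⟩ := hmod W₁
  obtain ⟨f₂, hf₂⟩ := hmod W₂
  obtain ⟨f₃, hf₃⟩ := hmod W₃
  let D₁ : W₁.SelmerDualData κ γ := W₁.selmerDualData κ hγ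
  let D₂ : W₂.SelmerDualData κ γ := W₂.selmerDualData κ hγ
  let D₃ : W₃.SelmerDualData κ γ := W₃.selmerDualData κ hγ
  -- period ratios, `p`-adic units
  obtain ⟨ϖ₀, hϖ₀⟩ := exists_periodRatio h5 W p hp hgood hirr f hf
  obtain ⟨ϖ₁, hϖ₁⟩ := exists_periodRatio h5 W₁ p hp hgood₁ hirr₁ f₁ hf₁
  obtain ⟨ϖ₂, hϖ₂⟩ := exists_periodRatio h5 W₂ p hp hgood₂ hirr₂ f₂ hf₂
  obtain ⟨ϖ₃, hϖ₃⟩ := exists_periodRatio h5 W₃ p hp hgood₃ hirr₃ f₃ hf₃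
  have hu₀ := norm_periodRatio_eq_one h5 W p hp hgood hirr f hf ϖ₀ hϖ₀
  have hu₁ := norm_periodRatio_eq_one h5 W₁ p hp hgood₁ hirr₁ f₁ hf₁ ϖ₁ hϖ₁
  have hu₂ := norm_periodRatio_eq_one h5 W₂ p hp hgood₂ hirr₂ f₂ hf₂ ϖ₂ hϖ₂
  have hu₃ := norm_periodRatio_eq_one h5 W₃ p hp hgood₃ hirr₃ f₃ hf₃ ϖ₃ hϖ₃
  -- (5.3)
  obtain ⟨G, hιG, hG⟩ := H W₁ W₂ W₃ ⟨C₁, hC₁⟩ ⟨C₂, hC₂⟩ ⟨C₃, hC₃⟩ f₁ f₂ f₃ hf₁ hf₂ hf₃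
    ϖ₀ ϖ₁ ϖ₂ ϖ₃ hϖ₀ hϖ₁ hϖ₂ hϖ₃ D D₁ D₂ D₃
  -- BCS Thm 1.1.2 (a) at the three twists
  obtain ⟨-, g₁, k₁, hg₁, hι₁⟩ := hBCS W₁ p κ γ f₁ hp hgood₁ hord₁ hirr₁ hκ hγ hγ' hf₁ D₁
  obtain ⟨-, g₂, k₂, hg₂, hι₂⟩ := hBCS W₂ p κ γ f₂ hp hgood₂ hord₂ hirr₂ hκ hγ hγ' hf₂ D₂
  obtain ⟨-, g₃, k₃, hg₃, hι₃⟩ := hBCS W₃ p κ γ f₃ hp hgood₃ hord₃ hirr₃ hκ hγ hγ' hf₃ D₃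
  -- THE NODE (exponent form), four times: `kᵢ ≤ 0`
  have hk₀ : k₀ ≤ 0 := hKMI W p hX9 κ γ f hκ hγ hγ' hf D g₀ k₀ hg₀ hι₀
  have hk₁ : k₁ ≤ 0 := hKMI W₁ p hX9₁ κ γ f₁ hκ hγ hγ' hf₁ D₁ g₁ k₁ hg₁ hι₁
  have hk₂ : k₂ ≤ 0 := hKMI W₂ p hX9₂ κ γ f₂ hκ hγ hγ' hf₂ D₂ g₂ k₂ hg₂ hι₂
  have hk₃ : k₃ ≤ 0 := hKMI W₃ p hX9₃ κ γ f₃ hκ hγ hγ' hf₃ D₃ g₃ k₃ hg₃ hι₃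
  -- Rohrlich: the four `p`-adic `L`-functions are non-zero
  have hL₀ := padicLFunction_unitRoot_ne_zero ⟨hgood, hord⟩ hf
  have hL₁ := padicLFunction_unitRoot_ne_zero ⟨hgood₁, hord₁⟩ hf₁
  have hL₂ := padicLFunction_unitRoot_ne_zero ⟨hgood₂, hord₂⟩ hf₂
  have hL₃ := padicLFunction_unitRoot_ne_zero ⟨hgood₃, hord₃⟩ hf₃
  -- `g₀ g₁ g₂ g₃ ∈ (G)`
  have hmem : g₀ * g₁ * g₂ * g₃ ∈ Ideal.span {G} := by
    refine hG ?_
    rw [hg₀, hg₁, hg₂, hg₃]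
    exact Ideal.mul_mem_mul (Ideal.mul_mem_mul (Ideal.mul_mem_mul
      (Ideal.mem_span_singleton_self _) (Ideal.mem_span_singleton_self _))
      (Ideal.mem_span_singleton_self _)) (Ideal.mem_span_singleton_self _)
  obtain ⟨r, hr⟩ := Ideal.mem_span_singleton'.mp hmem
  -- apply `ι` and cancel the product of the `L`-functions
  have hp0 : (p : ℚ_[p]) ≠ 0 := by exact_mod_cast hpP.ne_zero
  have e1 := congrArg (iwasawaToPowerSeries p) hr
  simp only [map_mul, hιG, hι₀, hι₁, hι₂, hι₃] at e1
  have key : iwasawaToPowerSeries p r *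
        PowerSeries.C ((ϖ₀ : ℚ_[p]) * ϖ₁ * ϖ₂ * ϖ₃) *
        (padicLFunction f (unitRoot W p : ℚ_[p]) * padicLFunction f₁ (unitRoot W₁ p : ℚ_[p]) *
          padicLFunction f₂ (unitRoot W₂ p : ℚ_[p]) * padicLFunction f₃ (unitRoot W₃ p : ℚ_[p])) =
      PowerSeries.C ((p : ℚ_[p]) ^ (k₀ + k₁ + k₂ + k₃)) *
        (padicLFunction f (unitRoot W p : ℚ_[p]) * padicLFunction f₁ (unitRoot W₁ p : ℚ_[p]) *
          padicLFunction f₂ (unitRoot W₂ p : ℚ_[p]) * padicLFunction f₃ (unitRoot W₃ p : ℚ_[p])) := by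
    simp only [zpow_add₀ hp0, map_mul]
    linear_combination e1
  have hLne : padicLFunction f (unitRoot W p : ℚ_[p]) * padicLFunction f₁ (unitRoot W₁ p : ℚ_[p]) *
      padicLFunction f₂ (unitRoot W₂ p : ℚ_[p]) * padicLFunction f₃ (unitRoot W₃ p : ℚ_[p]) ≠ 0 :=
    mul_ne_zero (mul_ne_zero (mul_ne_zero hL₀ hL₁) hL₂) hL₃
  have key2 : iwasawaToPowerSeries p r * PowerSeries.C ((ϖ₀ : ℚ_[p]) * ϖ₁ * ϖ₂ * ϖ₃) =
      PowerSeries.C ((p : ℚ_[p]) ^ (k₀ + k₁ + k₂ + k₃)) :=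
    mul_right_cancel₀ hLne key
  -- constant coefficients: `r(0) · ∏ ϖᵢ = p^{Σ kᵢ}` with `r(0) ∈ ℤ_p`, `|∏ ϖᵢ|_p = 1`
  have key3 := congrArg PowerSeries.constantCoeff key2
  simp only [map_mul, PowerSeries.constantCoeff_C, constantCoeff_iwasawaToPowerSeries] at key3
  have hnorm : ‖(p : ℚ_[p]) ^ (k₀ + k₁ + k₂ + k₃)‖ ≤ 1 := by
    rw [← key3, norm_mul, norm_mul, norm_mul, norm_mul, hu₀, hu₁, hu₂, hu₃, mul_one, mul_one,
      mul_one, mul_one, PadicInt.padic_norm_e_of_padicInt]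
    exact PadicInt.norm_le_one _
  have hsum : 0 ≤ k₀ + k₁ + k₂ + k₃ := by
    by_contra hlt
    push Not at hlt
    have hp1 : (1 : ℝ) < p := by exact_mod_cast hpP.one_lt
    have hgt : (1 : ℝ) < ‖(p : ℚ_[p]) ^ (k₀ + k₁ + k₂ + k₃)‖ := by
      rw [norm_zpow, Padic.norm_p, inv_zpow']
      exact one_lt_zpow₀ hp1 (by omega)
    exact absurd hnorm (not_le.mpr hgt)
  -- hence `k₀ = 0`
  have hk0 : k₀ = 0 := by omega
  refine ⟨g₀, hg₀, ?_⟩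
  rw [hι₀, hk0, zpow_zero, map_one, one_mul]

/-- **The leaf (glue shape of the would-be route `OneSidedTwistSqueezeX9`; `-imc` S-imc-1 ported).**
The node + the printed display (5.3) + the SmallImageMuTransfer route's shared items `PublishedInputsX9`
(stmt-BirchSwinnertonDyer-19632: BCS (a), Greenberg 4.1, period unit, Schneider 1985, Perrin-Riou,
modularity, entire `L`, GZK — cite-only conjunction) and `SchneiderX9RankOne` (stmt-…-19631) decide the
class leaf `BSDpOnClassX9`, through the kernel bridge `bsdpOnClassX9_of_integralMainConjectureOnClassX9`.
It REPLACES the pair {`MuTransfer` (19629), `AnalyticMuZeroX9` (19630)} of that route's `closes` by the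
single one-sided node.  CONDITIONAL; credits nothing toward any closure.
[cite: BurungaleCastellaSkinner2025, display (5.3) (p. 10 of arXiv:2405.00270v2)]
[cite: GreenbergLNM1716, Thm. 4.1 (p. 102)] -/
theorem bsdpOnClassX9_of_katoDivisibility_squeeze
    (hC1 : KatoDivisibilityOnClassX9)
    (h53 : display53_prod_charIdeal_le_prod_padicLFunction)
    (hPub : Summit.BirchSwinnertonDyer.BirchSwinnertonDyer.Theses.SmallImageMuTransfer.PublishedInputsX9)
    (hC3 : Summit.BirchSwinnertonDyer.BirchSwinnertonDyer.Theses.SmallImageMuTransfer.SchneiderX9RankOne) :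
    BSDpOnClassX9 := by
  obtain ⟨hBCS, hGr, h5, hS, hPR, hmodP, hmodL, hGZK⟩ := hPub
  exact bsdpOnClassX9_of_integralMainConjectureOnClassX9 hGr h5 hS hPR hmodP hmodL hGZK
    (integralMainConjectureOnClassX9_of_katoDivisibility_squeeze hC1 h53 hBCS h5
      (exists_isNewformOf_of_nonempty_modularParametrizationData hmodP)) hC3

end Squeeze

end Summit.BirchSwinnertonDyer.Rank1Residual.SmallImageMu

end
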